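import Summits.QuantumFields.YangMills.Theorems.BalabanUVNodesN12RootedForest
import Summits.QuantumFields.YangMills.Theorems.BalabanUVNodesN12FlatHndBjAllZ
import Literature.MathematicalPhysics.QuantumFieldTheory.Balaban1983to89.B15Prop1AxialGaugeSectionOfForest
import HarnessLib

/-!
# BalabanUVNodes ∕ N12 — THE FOREST SLICE: (β)♭ at NODE 00's flat multi-scale chart for the slice of a rooted forest (general `𝐁` modulo (L♭)+(C); the record's `𝐁_k(Z)` for every `Z`
# with every geometric letter discharged), the slice as a conjugation-stable complex submodule (letter (F3)), and the junction with dag-n12-w6's criticality transfer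
# `B15Prop1AxialGaugeSectionOfForest.hcritT_isCritOnFibre_of_forest` with its forest letters (F1)(F2) inhabited — after this file the N12 criticality transfer displays NO comb choice

Cell `pub-ymgap` (HUMAN RULINGS D-0062 ∕ D-0149), WIDTH SEAT `pub-ymgap-dag-n12-w3` g3 (node N12 = [B15]; key K1⁷ `stmt-QuantumFields-20542`, `--kind proof --supports … --as helper`;
count-neutral).  THEOREMS ONLY (0 `def`, 0 `instance`, 0 `sorry`); consumed BY NAME: this seat's `N12RootedForest.grad_eq_zero_of_forest_of_locConst` ∕ `forest_F1` ∕ `exists_rootedForest_Bj`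
(the companion file), `N12FlatHndHarmonicLetter.exists_locConstGauge_of_plaq_eq_zero_of_iterLin_eq_zero_of_harmonic` ∕ `harmonic_Bj` (p612004), `N12FlatHndConnLetter.hconn_Bj` (p610526),
`N12FlatHndRecordLetters.deriv_deriv_eq_zero_of_fderiv_fderiv_diag_eq_zero` (p608348), `N12FlatFibreNullSpaceDetSet.iterLin_eq_zero_of_fderiv_msChart_one_eq_zero_detSet` (p605331),
`N12FlatChartHnd.coe_plaq_eq_zero_of_deriv_deriv_eq_zero` ∕ `deriv_deriv_wilsonAction4_expChart_one_nonneg` (p602928); dag-n12-w6's `B15Prop1AxialGaugeSectionOfForest.hcritT_isCritOnFibre_of_forest`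
(p612182); dag-n12-w1's `B15ComplexifiedDatumFamily.conjVec`.

WHY.  See the companion `BalabanUVNodesN12RootedForest` (LOCATED-GAUGE: print's `Ax_k(𝔅_k, U₀)` of [Balaban1985RegularSpaces] (1.19) is the block-hierarchical averaged axial gauge, whose
flat linearisation is the `hierAxial` slice of this seat's files 8–14; dag-n12-w6's (σ1)–(σ4) run in the fine-lattice TREE GAUGE of a rooted forest; both are honest gauges for the residual
group (4)∕(1.14) of [Balaban1985Variational], and the per-base-field letters `hH` ∕ (β) ∕ `hcritT` of dag-n12-w1's `hMin_atRecord_of_node00Letters` need ONE slice serving all three).  This file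
is the (β)♭ half for the forest slice, in the three consumer shapes of `N12FlatHndBjAllZ` ∕ `N12FlatHndHarmonicLetter` (curve form, positivity form, bilinear real `hnondeg`), and the slice ∕
criticality-transfer junction.  The mechanism is that of files 6 ∕ 10: `DΦ(0)X = 0` kills the linearised averages `Q^{(j)}↑X` at the constrained bonds, the vanishing flat second variation makes
`↑X` curl-free, the harmonic letter (L♭) makes it a gradient `dφ₀` with `φ₀` constant along every constrained bond at the centres, and a potential constant along the forest AND along the
constrained bonds is constant by the companion's transversality (every site carries its root's value; (C) identifies the root values).  The slice letter is «`X = 0` on every path bond» —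
NO `Q`-recursion data enters it (contrast `hierAxial`).

CONTENTS.  §1 at NODE 00's flat chart: ★★★ `eq_zero_of_fderiv_msChart_one_eq_zero_of_forest_of_harmonic` (general `𝐁`, modulo (L♭)+(C)), ★★★ `eq_zero_of_fderiv_msChart_one_eq_zero_of_forest_Bj` ∕
★★ `deriv_deriv_pos_of_fderiv_msChart_one_eq_zero_of_forest_Bj` ∕ ★★★ `hnondeg_real_flat_forest_Bj_allZ` (the record's `𝐁_k(Z)`, every `Z`: (L♭) ← `harmonic_Bj`, (C) ← `hconn_Bj`; (TREE)
is inhabited by the companion's `exists_rootedForest_Bj`).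
§2 ★ `exists_forestSlice` (the slice as a conjugation-stable `ℂ`-submodule of `VecField P 0 (EuclideanSpace ℂ (Fin 3))`, (F3) by `Iff.rfl`), ★★ `hcritT_isCritOnFibre_of_forestSlice`
(p612182's `hcritT_isCritOnFibre_of_forest` with (F1) DERIVED from (F2)+(TREE) — the «one application» of dag-n12-w6's OFFER-4), ★★ `exists_forest_slice_Bj` (everything assembled at
the record: `∃ path S`, (F1) ∧ (F2) ∧ (TREE) ∧ (F3) ∧ conjugation-stability).

HONEST FRAMING.  Flat configuration only in §1; a fine-lattice tree gauge in place of print's block-hierarchical averaged `Ax_k` ((1.19)); linear algebra and bookkeeping; no constants;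
nothing of Bałaban's estimates asserted; (E), `hT1u`, the onto letter `hH` (companion's residual decomposition + dag-n10-w1's WAY (ii)) and the near-flat (β) stay displayed in the lane;
N12 NOT discharged; K1⁷ NOT closed; counts unmoved (typed 28∕28 · discharged 5∕27); one finite 𝕋⁴ programme at fixed ε — R4 closes the conditional rung `BalabanLadder.UV` only; the
Yang–Mills mass gap (Clay) is NOT proved by any of this; nothing continuum ∕ ℝ⁴ ∕ OS.
-/

noncomputable section

namespace Summit.QuantumFields.YangMills.BalabanUVNodes.N12ForestSlice

open scoped BigOperators Matrix.Norms.L2Operator Topology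
open Literature.MathematicalPhysics.QuantumFieldTheory.Balaban1983to89
open T4Continuum
open B15DeterminingSets
open Summit.QuantumFields.YangMills.BalabanUVNodes.N12RootedForest (grad_eq_zero_of_forest_of_locConst forest_F1 exists_rootedForest_Bj)

variable {P : Params}

/-! ## §1 At NODE 00's flat multi-scale chart: (β)♭ for the forest slice -/

section NodeZero

open BlockAveragingEMLLinearised (linAvg)
open T4AdjointCovarianceUnitary (lieSU)
open Node00
open Literature.MathematicalPhysics.QuantumFieldTheory.Balaban1983to89.B14.Eq213DetSet (Bj)
open Literature.MathematicalPhysics.QuantumFieldTheory.Balaban1983to89.B14.Eq213MaximalDomains (side)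
open N12FlatFibreNullSpaceDetSet (iterLin_eq_zero_of_fderiv_msChart_one_eq_zero_detSet)
open N12FlatChartHnd (coe_plaq_eq_zero_of_deriv_deriv_eq_zero deriv_deriv_wilsonAction4_expChart_one_nonneg)
open N12FlatHndHarmonicLetter (harmonic_Bj exists_locConstGauge_of_plaq_eq_zero_of_iterLin_eq_zero_of_harmonic)

variable {F : T4Family} {N : ℕ} [NeZero N] {K k : ℕ} {M₁ : ℕ} {Z : Set (Site (F.P K) 0)}

/-- ★★★ **(β)♭ AT NODE 00's FLAT CHART ON THE FOREST SLICE, GENERAL `𝐁`, MODULO (L♭) AND (C)**: for a forest in which every site off `R(𝐁, k)` hangs (TREE), a field `X` vanishing on every path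
bond with `DΦ(0)X = 0` and `d²∕ds² A(e^{sX})|₀ = 0` is `0`.  The slice letter carries no `Q`-recursion data: the recursion is built inside, `DΦ(0)X = 0` kills `Q^{(j)}↑X` at the constrained
bonds (`iterLin_eq_zero_of_fderiv_msChart_one_eq_zero_detSet`), the flat second variation makes `↑X` a locally-constant gradient under (L♭) (`exists_locConstGauge_…_of_harmonic`), and §2 ends it.
[cite: Balaban1989LargeFieldII, (1.9) p.358, p.359; Balaban1985Variational, (4) p.278, (16)–(18) p.280; Balaban1988Convergent, (2.2) p.255, (2.10)–(2.13) pp.256-257] -/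
theorem eq_zero_of_fderiv_msChart_one_eq_zero_of_forest_of_harmonic (𝔹 : DetSet (F.P K))
    (hharm : ∀ (φ₀ : Site (F.P K) 0 → Matrix (Fin N) (Fin N) ℂ) (A : Fin (F.P K).d → Matrix (Fin N) (Fin N) ℂ),
      (∀ j, j ≤ k → ∀ c ∈ bondsOf (𝔹 j), φ₀ (embIter j c.tgt) - φ₀ (embIter j c.src) + ((F.P K).L ^ j : ℕ) • A c.dir = 0) → ∀ μ, A μ = 0)
    (hconn : ∀ ψ : Site (F.P K) 0 → Matrix (Fin N) (Fin N) ℂ, (∀ j, j ≤ k → ∀ c ∈ bondsOf (𝔹 j), ψ (embIter j c.tgt) = ψ (embIter j c.src)) →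
      ∀ j j', j ≤ k → j' ≤ k → ∀ c ∈ bondsOf (𝔹 j), ∀ c' ∈ bondsOf (𝔹 j'), ψ (embIter j c.src) = ψ (embIter j' c'.src))
    {path : Site (F.P K) 0 → List (LStep (F.P K) 0)}
    (htree : ∀ x : Site (F.P K) 0, x ∉ {z : Site (F.P K) 0 | ∃ j, j ≤ k ∧ ∃ c ∈ bondsOf (𝔹 j), (z = embIter j c.src ∨ z = embIter j c.tgt)} →
      ∃ (x' : Site (F.P K) 0) (s : LStep (F.P K) 0), path x = path x' ++ [s] ∧
        (s.fwd = true → s.bond.src = x' ∧ s.bond.tgt = x) ∧ (s.fwd = false → s.bond.src = x ∧ s.bond.tgt = x'))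
    {X : PBond (F.P K) 0 → lieSU (Fin N)} (hax : ∀ x, ∀ s ∈ path x, X s.bond = 0)
    (hker : fderiv ℝ (msChart F N K k 𝔹 (avgFamily (avOfRecord F N K) (1 : GaugeField (F.P K) 0 (SU N))) (1 : GaugeField (F.P K) 0 (SU N))) 0 X = 0)
    (hflat : deriv (deriv fun s : ℝ => wilsonAction4 (expChart (1 : GaugeField (F.P K) 0 (SU N)) (s • X))) 0 = 0) :
    X = 0 := by
  obtain ⟨Q, hQ0, hQs⟩ : ∃ Q : (i : ℕ) → (PBond (F.P K) 0 → Matrix (Fin N) (Fin N) ℂ) → PBond (F.P K) i → Matrix (Fin N) (Fin N) ℂ,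
      (∀ Y, Q 0 Y = Y) ∧ ∀ (i : ℕ) (Y : PBond (F.P K) 0 → Matrix (Fin N) (Fin N) ℂ) (c : PBond (F.P K) (i + 1)), Q (i + 1) Y c = linAvg (Q i Y) c :=
    ⟨fun i => Nat.rec (motive := fun i => (PBond (F.P K) 0 → Matrix (Fin N) (Fin N) ℂ) → PBond (F.P K) i → Matrix (Fin N) (Fin N) ℂ) (fun Y => Y)
      (fun _ Qi Y c => linAvg (Qi Y) c) i, fun _ => rfl, fun _ _ _ => rfl⟩
  have hQ : ∀ j, j ≤ k → ∀ c ∈ bondsOf (𝔹 j), Q j (fun b => (X b : Matrix (Fin N) (Fin N) ℂ)) c = 0 := fun j hj c hc =>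
    iterLin_eq_zero_of_fderiv_msChart_one_eq_zero_detSet Q hQ0 hQs 𝔹 hker hj hc
  obtain ⟨φ₀, hφ₀, hXφ₀⟩ := exists_locConstGauge_of_plaq_eq_zero_of_iterLin_eq_zero_of_harmonic Q hQ0 hQs 𝔹 k hharm
    (fun b => (X b : Matrix (Fin N) (Fin N) ℂ)) (coe_plaq_eq_zero_of_deriv_deriv_eq_zero X hflat) hQ
  have hgrad := grad_eq_zero_of_forest_of_locConst 𝔹 k htree hconn φ₀ hφ₀ fun x s hs =>
    sub_eq_zero.1 (by rw [← hXφ₀ s.bond, hax x s hs]; rfl)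
  funext b
  exact Subtype.ext (by rw [hXφ₀ b, hgrad b]; rfl)

/-- ★★★ **(β)♭ ON THE FOREST SLICE FOR THE RECORD's `𝐁_k(Z)`, EVERY `Z`, CURVE FORM** — (L♭) ← `N12FlatHndHarmonicLetter.harmonic_Bj`, (C) ← `N12FlatHndConnLetter.hconn_Bj`; left displayed:
`1 ≤ M₁`, `1 ≤ k ≤ m + K`, the cover divisibility, (TREE) for the forest (§4 `exists_rootedForest_Bj` supplies it), the slice membership, the kernel letter, the flat second variation.
[cite: Balaban1989LargeFieldII, (1.9) p.358, p.359; Balaban1985Variational, (4) p.278; Balaban1988Convergent, (2.2) p.255, (2.13) pp.256-257] -/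
theorem eq_zero_of_fderiv_msChart_one_eq_zero_of_forest_Bj (hk : k ≤ (F.P K).m + (F.P K).K) (hk1 : 1 ≤ k) (hM : 1 ≤ M₁)
    (hdiv : side (F.P K).L M₁ k ∣ (F.P K).sitesPerDir 0)
    {path : Site (F.P K) 0 → List (LStep (F.P K) 0)}
    (htree : ∀ x : Site (F.P K) 0, x ∉ {z : Site (F.P K) 0 | ∃ j, j ≤ k ∧ ∃ c ∈ bondsOf ((Bj M₁ Z k : DetSet (F.P K)) j), (z = embIter j c.src ∨ z = embIter j c.tgt)} →
      ∃ (x' : Site (F.P K) 0) (s : LStep (F.P K) 0), path x = path x' ++ [s] ∧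
        (s.fwd = true → s.bond.src = x' ∧ s.bond.tgt = x) ∧ (s.fwd = false → s.bond.src = x ∧ s.bond.tgt = x'))
    {X : PBond (F.P K) 0 → lieSU (Fin N)} (hax : ∀ x, ∀ s ∈ path x, X s.bond = 0)
    (hker : fderiv ℝ (msChart F N K k (Bj M₁ Z k) (avgFamily (avOfRecord F N K) (1 : GaugeField (F.P K) 0 (SU N))) (1 : GaugeField (F.P K) 0 (SU N))) 0 X = 0)
    (hflat : deriv (deriv fun s : ℝ => wilsonAction4 (expChart (1 : GaugeField (F.P K) 0 (SU N)) (s • X))) 0 = 0) :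
    X = 0 :=
  eq_zero_of_fderiv_msChart_one_eq_zero_of_forest_of_harmonic (Bj M₁ Z k) (harmonic_Bj hM hk1 hk hdiv)
    (N12FlatHndConnLetter.hconn_Bj hM hk1 hk hdiv) htree hax hker hflat

/-- ★★ **POSITIVITY FORM, `𝐁_k(Z)`, EVERY `Z`**: a nonzero `X` in the forest slice with `DΦ(0)X = 0` has `0 < d²∕ds² A(e^{sX})|₀` (the flat second variation is nonnegative and vanishes only at
`X = 0` by the curve form). [cite: Balaban1989LargeFieldII, (1.9) p.358, p.359; Balaban1985Variational, (4) p.278] -/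
theorem deriv_deriv_pos_of_fderiv_msChart_one_eq_zero_of_forest_Bj (hk : k ≤ (F.P K).m + (F.P K).K) (hk1 : 1 ≤ k) (hM : 1 ≤ M₁)
    (hdiv : side (F.P K).L M₁ k ∣ (F.P K).sitesPerDir 0)
    {path : Site (F.P K) 0 → List (LStep (F.P K) 0)}
    (htree : ∀ x : Site (F.P K) 0, x ∉ {z : Site (F.P K) 0 | ∃ j, j ≤ k ∧ ∃ c ∈ bondsOf ((Bj M₁ Z k : DetSet (F.P K)) j), (z = embIter j c.src ∨ z = embIter j c.tgt)} →
      ∃ (x' : Site (F.P K) 0) (s : LStep (F.P K) 0), path x = path x' ++ [s] ∧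
        (s.fwd = true → s.bond.src = x' ∧ s.bond.tgt = x) ∧ (s.fwd = false → s.bond.src = x ∧ s.bond.tgt = x'))
    {X : PBond (F.P K) 0 → lieSU (Fin N)} (hX0 : X ≠ 0) (hax : ∀ x, ∀ s ∈ path x, X s.bond = 0)
    (hker : fderiv ℝ (msChart F N K k (Bj M₁ Z k) (avgFamily (avOfRecord F N K) (1 : GaugeField (F.P K) 0 (SU N))) (1 : GaugeField (F.P K) 0 (SU N))) 0 X = 0) :
    0 < deriv (deriv fun s : ℝ => wilsonAction4 (expChart (1 : GaugeField (F.P K) 0 (SU N)) (s • X))) 0 :=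
  lt_of_le_of_ne (deriv_deriv_wilsonAction4_expChart_one_nonneg X) fun h =>
    hX0 (eq_zero_of_fderiv_msChart_one_eq_zero_of_forest_Bj hk hk1 hM hdiv htree hax hker h.symm)

/-- ★★★ **THE FLAT REAL `hnondeg` LETTER ON THE FOREST SLICE FOR `𝐁_k(Z)`, EVERY `Z`** (the bilinear shape of dag-n12-w1's letter (β) before complexification, as in
`N12FlatHndHarmonicLetter.hnondeg_real_flat_hierAxial_Bj_allZ`, with the hierarchical axial slice replaced by the forest slice): `s` in the slice and in `ker DΦ(0)` whose flat Hessian against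
every slice vector of `ker DΦ(0)` vanishes is `0` (only `t = s` is used). [cite: Balaban1989LargeFieldII, (1.9) p.358, p.359; Balaban1985Variational, (4) p.278, (16)–(18) p.280] -/
theorem hnondeg_real_flat_forest_Bj_allZ (hk : k ≤ (F.P K).m + (F.P K).K) (hk1 : 1 ≤ k) (hM : 1 ≤ M₁)
    (hdiv : side (F.P K).L M₁ k ∣ (F.P K).sitesPerDir 0)
    {path : Site (F.P K) 0 → List (LStep (F.P K) 0)}
    (htree : ∀ x : Site (F.P K) 0, x ∉ {z : Site (F.P K) 0 | ∃ j, j ≤ k ∧ ∃ c ∈ bondsOf ((Bj M₁ Z k : DetSet (F.P K)) j), (z = embIter j c.src ∨ z = embIter j c.tgt)} →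
      ∃ (x' : Site (F.P K) 0) (s : LStep (F.P K) 0), path x = path x' ++ [s] ∧
        (s.fwd = true → s.bond.src = x' ∧ s.bond.tgt = x) ∧ (s.fwd = false → s.bond.src = x ∧ s.bond.tgt = x'))
    (s : PBond (F.P K) 0 → lieSU (Fin N)) (hs : ∀ x, ∀ u ∈ path x, s u.bond = 0)
    (hker : fderiv ℝ (msChart F N K k (Bj M₁ Z k) (avgFamily (avOfRecord F N K) (1 : GaugeField (F.P K) 0 (SU N))) (1 : GaugeField (F.P K) 0 (SU N))) 0 s = 0)
    (hq : ∀ t : PBond (F.P K) 0 → lieSU (Fin N), (∀ x, ∀ u ∈ path x, t u.bond = 0) →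
      fderiv ℝ (msChart F N K k (Bj M₁ Z k) (avgFamily (avOfRecord F N K) (1 : GaugeField (F.P K) 0 (SU N))) (1 : GaugeField (F.P K) 0 (SU N))) 0 t = 0 →
      fderiv ℝ (fun Y => fderiv ℝ (fun Y : PBond (F.P K) 0 → lieSU (Fin N) => wilsonAction4 (expChart (1 : GaugeField (F.P K) 0 (SU N)) Y)) Y) 0 s t = 0) :
    s = 0 :=
  eq_zero_of_fderiv_msChart_one_eq_zero_of_forest_Bj hk hk1 hM hdiv htree hs hker
    (N12FlatHndRecordLetters.deriv_deriv_eq_zero_of_fderiv_fderiv_diag_eq_zero s (hq s hs hker))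

end NodeZero

/-! ## §2 The forest slice as a submodule; the junction with the criticality transfer -/

section Junction

open Literature.MathematicalPhysics.QuantumFieldTheory.Balaban1983to89.B14.Eq213DetSet (Bj)
open Literature.MathematicalPhysics.QuantumFieldTheory.Balaban1983to89.B14.Eq213MaximalDomains (side)
open B15ComplexifiedDatumFamily (conjVec)

/-- ★ **THE FOREST SLICE AS A CONJUGATION-STABLE COMPLEX SUBMODULE** (letter (F3) of `B15Prop1AxialGaugeSectionOfForest.exists_gaugeSection_of_forest` by `Iff.rfl`; the conjugation
clause of dag-n12-w1's `hbase`): the `ℂ³`-valued bond fields vanishing on every path bond. [cite: Balaban1985RegularSpaces, (1.19) p.79; Balaban1989LargeFieldI, Prop. 1 p.194 («B′ ∈ 𝔤ᶜ»)] -/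
theorem exists_forestSlice (path : Site P 0 → List (LStep P 0)) :
    ∃ S : Submodule ℂ (VecField P 0 (EuclideanSpace ℂ (Fin 3))),
      (∀ X, X ∈ S ↔ ∀ x, ∀ s ∈ path x, X s.bond = 0) ∧ (∀ X ∈ S, conjVec X ∈ S) := by
  refine ⟨{ carrier := {X | ∀ x, ∀ s ∈ path x, X s.bond = 0}
            add_mem' := fun {X Y} hX hY x s hs => by simp only [Pi.add_apply, hX x s hs, hY x s hs, add_zero]
            zero_mem' := fun _ _ _ => rfl
            smul_mem' := fun c X hX x s hs => by simp only [Pi.smul_apply, hX x s hs, smul_zero] }, fun X => Iff.rfl,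
    fun X hX x s hs => ?_⟩
  have h : X s.bond = 0 := hX x s hs
  ext a
  simp [conjVec, h]

open scoped Topology
open Set Metric Filter
open Node00 (SU coeField SmallBelow constrCard constrEnum IsCritOnFibre avOfRecord)
open B15AveragingHolomorphic (iterMh)
open B15SU2ChartHolomorphic (expMulC logCoordC)
open ExpMeanLog (expMeanLogSU)
open BlockAveraging (blockAvg)
open T4CubeChartGnomonic (SU2)
open B15Prop1AxialGaugeSectionOfForest (hcritT_isCritOnFibre_of_forest)

variable {F : T4Family}

/-- ★★ **THE N12 CRITICALITY TRANSFER ON A FOREST SLICE, NO COMB CHOICE DISPLAYED** — dag-n12-w6's `B15Prop1AxialGaugeSectionOfForest.hcritT_isCritOnFibre_of_forest` with its letter (F1)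
DERIVED from (F2)+(TREE) (`forest_F1`): base-field data + a rooted forest whose roots contain `R(𝐁, k)` (F2) and in which every site off `R(𝐁, k)` hangs (TREE) + its slice (F3) ⟹
n07-e's `Node00.IsCritOnFibre` for the slice-chart points near the base datum that are Lagrange-critical on the slice.  With `exists_rootedForest_detSet` ∕ `exists_rootedForest_Bj` and
`exists_forestSlice` every displayed forest letter is inhabited. [cite: Balaban1985Variational, Thm 1 p.279, (4) p.278, (16)–(18) p.280, Sect. F p.300; Balaban1985RegularSpaces, (1.19) p.79; Balaban1988Convergent, (2.10)–(2.13) pp.256–257; Balaban1989LargeFieldI, Prop. 1 p.194] -/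
theorem hcritT_isCritOnFibre_of_forestSlice (Kt : ℕ) (𝔹 : DetSet (F.P Kt)) (k : ℕ) (hk : k ≤ (F.P Kt).m + (F.P Kt).K) (h𝔹 : ∀ j, k < j → 𝔹 j = ∅)
    {Q₀ U₀ : GaugeField (F.P Kt) 0 SU2}
    (hsbQ : SmallBelow (fun j => blockAvg (P := F.P Kt) (j := j) expMeanLogSU) k Q₀)
    (hsbU : SmallBelow (fun j => blockAvg (P := F.P Kt) (j := j) expMeanLogSU) k U₀)
    (hU₀ : AgreeOn 𝔹 (avgFamily (fun j => blockAvg (P := F.P Kt) (j := j) expMeanLogSU) U₀) (avgFamily (fun j => blockAvg (P := F.P Kt) (j := j) expMeanLogSU) Q₀))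
    (S : Submodule ℂ (VecField (F.P Kt) 0 (EuclideanSpace ℂ (Fin 3))))
    (a : S → ℂ)
    (ha : ∀ X : S, a X = ∑ p : Plaq (F.P Kt) 0, (1 - (expMulC (X : VecField (F.P Kt) 0 (EuclideanSpace ℂ (Fin 3))) (coeField U₀) ⟨p.src, p.μ⟩ *
      expMulC (X : VecField (F.P Kt) 0 (EuclideanSpace ℂ (Fin 3))) (coeField U₀) ⟨p.src.shift p.μ, p.ν⟩ *
      Matrix.adjugate (expMulC (X : VecField (F.P Kt) 0 (EuclideanSpace ℂ (Fin 3))) (coeField U₀) ⟨p.src.shift p.ν, p.μ⟩) *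
      Matrix.adjugate (expMulC (X : VecField (F.P Kt) 0 (EuclideanSpace ℂ (Fin 3))) (coeField U₀) ⟨p.src, p.ν⟩)).trace / 2))
    (Φ₀ : S → Fin (constrCard 𝔹 k) → EuclideanSpace ℂ (Fin 3))
    (hΦ₀ : ∀ (X : S) i, Φ₀ X i = logCoordC (star ((avgFamily (fun j => blockAvg (P := F.P Kt) (j := j) expMeanLogSU) Q₀ ((constrEnum 𝔹 k).symm i).1
      ((constrEnum 𝔹 k).symm i).2.1 : SU2) : Matrix (Fin 2) (Fin 2) ℂ) *
      iterMh ((constrEnum 𝔹 k).symm i).1 (expMulC (X : VecField (F.P Kt) 0 (EuclideanSpace ℂ (Fin 3))) (coeField U₀)) ((constrEnum 𝔹 k).symm i).2.1))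
    -- the forest: roots ⊇ R(𝐁, k) (F2), every other site hangs (TREE), and its slice (F3)
    {path : Site (F.P Kt) 0 → List (LStep (F.P Kt) 0)}
    (hF2 : ∀ j, j ≤ k → ∀ c ∈ bondsOf (𝔹 j), path (embIter j c.src) = [] ∧ path (embIter j c.tgt) = [])
    (htree : ∀ x : Site (F.P Kt) 0, x ∉ {z : Site (F.P Kt) 0 | ∃ j, j ≤ k ∧ ∃ c ∈ bondsOf (𝔹 j), (z = embIter j c.src ∨ z = embIter j c.tgt)} →
      ∃ (x' : Site (F.P Kt) 0) (s : LStep (F.P Kt) 0), path x = path x' ++ [s] ∧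
        (s.fwd = true → s.bond.src = x' ∧ s.bond.tgt = x) ∧ (s.fwd = false → s.bond.src = x ∧ s.bond.tgt = x'))
    (hF3 : ∀ X : VecField (F.P Kt) 0 (EuclideanSpace ℂ (Fin 3)), X ∈ S ↔ ∀ x, ∀ s ∈ path x, X s.bond = 0) :
    ∀ᶠ w in 𝓝 ((0 : S), coeField Q₀), ∀ (U' Q' : GaugeField (F.P Kt) 0 SU2) (μ : (Fin (constrCard 𝔹 k) → EuclideanSpace ℂ (Fin 3)) →L[ℂ] ℂ),
      expMulC (w.1 : VecField (F.P Kt) 0 (EuclideanSpace ℂ (Fin 3))) (coeField U₀) = coeField U' → coeField Q' = w.2 →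
        AgreeOn 𝔹 (avgFamily (fun j => blockAvg (P := F.P Kt) (j := j) expMeanLogSU) U') (avgFamily (fun j => blockAvg (P := F.P Kt) (j := j) expMeanLogSU) Q') →
        fderiv ℂ a w.1 = μ.comp (fderiv ℂ Φ₀ w.1) →
          IsCritOnFibre F 2 Kt 𝔹 (avgFamily (avOfRecord F 2 Kt) Q') U' :=
  have hroot : ∀ r ∈ {z : Site (F.P Kt) 0 | ∃ j, j ≤ k ∧ ∃ c ∈ bondsOf (𝔹 j), (z = embIter j c.src ∨ z = embIter j c.tgt)}, path r = [] := by
    rintro r ⟨j, hj, c, hc, rfl | rfl⟩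
    · exact (hF2 j hj c hc).1
    · exact (hF2 j hj c hc).2
  hcritT_isCritOnFibre_of_forest Kt 𝔹 k hk h𝔹 hsbQ hsbU hU₀ S a ha Φ₀ hΦ₀ path (forest_F1 hroot htree) hF2 hF3

/-- ★★ **EVERYTHING ASSEMBLED AT THE RECORD's `𝐁_k(Z)`, EVERY `Z`**: a rooted forest `path` with (F1), (F2), (TREE) at `R(𝐁_k(Z), k)` and its conjugation-stable forest slice `S` with (F3) —
the `path`∕`S` data every forest letter of this file and of `B15Prop1AxialGaugeSectionOfForest` consumes. [cite: Balaban1985Variational, (4) p.278, (16)–(18) p.280; Balaban1985RegularSpaces, (1.19) p.79; Balaban1988Convergent, (2.2) p.255, (2.13) pp.256–257] -/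
theorem exists_forest_slice_Bj {k M₁ : ℕ} {Z : Set (Site P 0)} (hk : k ≤ P.m + P.K) (hk1 : 1 ≤ k) (hM : 1 ≤ M₁) (hdiv : side P.L M₁ k ∣ P.sitesPerDir 0) :
    ∃ (path : Site P 0 → List (LStep P 0)) (S : Submodule ℂ (VecField P 0 (EuclideanSpace ℂ (Fin 3)))),
      (∀ x, ∀ s ∈ path x, ∃ x' x'' : Site P 0, path x'' = path x' ++ [s] ∧
        (s.fwd = true → s.bond.src = x' ∧ s.bond.tgt = x'') ∧ (s.fwd = false → s.bond.src = x'' ∧ s.bond.tgt = x')) ∧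
      (∀ j, j ≤ k → ∀ c ∈ bondsOf ((Bj M₁ Z k : DetSet P) j), path (embIter j c.src) = [] ∧ path (embIter j c.tgt) = []) ∧
      (∀ x : Site P 0, x ∉ {z : Site P 0 | ∃ j, j ≤ k ∧ ∃ c ∈ bondsOf ((Bj M₁ Z k : DetSet P) j), (z = embIter j c.src ∨ z = embIter j c.tgt)} →
        ∃ (x' : Site P 0) (s : LStep P 0), path x = path x' ++ [s] ∧
          (s.fwd = true → s.bond.src = x' ∧ s.bond.tgt = x) ∧ (s.fwd = false → s.bond.src = x ∧ s.bond.tgt = x')) ∧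
      (∀ X, X ∈ S ↔ ∀ x, ∀ s ∈ path x, X s.bond = 0) ∧ (∀ X ∈ S, conjVec X ∈ S) := by
  obtain ⟨path, h1, h2, h3⟩ := exists_rootedForest_Bj (Z := Z) hk hk1 hM hdiv
  obtain ⟨S, hS, hconj⟩ := exists_forestSlice path
  exact ⟨path, S, h1, h2, h3, hS, hconj⟩

end Junction

end Summit.QuantumFields.YangMills.BalabanUVNodes.N12ForestSlice

end
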